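import Mathlib.LinearAlgebra.Eigenspace.Triangularizable
import Mathlib.LinearAlgebra.Projection
import Literature.NumberTheory.GaloisRepresentations.ContinuousRep
import HarnessLib

/-!
# The commutant of a reducible representation along a cyclic layer: linear algebra

Topic `NumberTheory/GaloisRepresentations`; namespace
`Literature.NumberTheory.GaloisRepresentations`.  Theorems only: **no definition and no named
fact is introduced**.  This file is the linear-algebra half of Clifford's dichotomy in twist form
(`CliffordTwistDichotomy`: an irreducible framed representation `r : G →ₜ* GL_n(A)` whose
restriction along an open embedding `f : H →ₜ* G` with normal image and finite cyclic quotient is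
reducible is isomorphic to a non-trivial twist `r ⊗ χ`, `χ` a character of `G / f(H)`).

* `exists_conj_eq_smul_of_mem_centralizer` — the core.  Let `R` be a finite-dimensional algebra
  over an algebraically closed field `A` of characteristic zero, `S ⊆ R`, `b ∈ Rˣ`, `d > 0` with
  `b⁻¹ S b ⊆ S`, such that `b ^ d` commutes with the commutant `E` of `S` and the elements of `E`
  commuting with `b` are scalars.  If `E` is not reduced to the scalars, there are `ζ ∈ A`,
  `ζ ^ d = 1`, `ζ ≠ 1`, and `T ∈ E`, `T ≠ 0`, with `b T b⁻¹ = ζ T`.  Proof: conjugation by `b` is a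
  linear endomorphism `Φ` of `E` with `Φ ^ d = 1` whose fixed points are the scalars; the
  averaging operator `e = ∑_{k<d} Φᵏ` maps `E` to the scalars, its kernel `K` is `Φ`-stable and
  non-zero (it contains `T₀ - d⁻¹ e T₀` for a non-scalar `T₀ ∈ E`; characteristic zero), and an
  eigenvector of `Φ` on `K` (`Module.End.exists_eigenvalue`) has eigenvalue `ζ` with `ζ ^ d = 1`
  (`Φ ^ d = 1`) and `ζ ≠ 1` (a fixed vector `T` of `K` has `e T = d T = 0`).
* `FramedRep.exists_comm_ne_algebraMap_of_not_isIrreducible` — a reducible SEMISIMPLE framed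
  representation `r : H →ₜ* GL_n(A)` with `n > 0` has a non-scalar matrix commuting with all
  `r h`: the projection (`Submodule.projection`) onto a proper non-trivial subrepresentation
  along an invariant complement.

In `CliffordTwistDichotomy` these are applied with `R = M_n(A)`, `S = r(f(H))`, `b = r(τ₀)` for
`τ₀` generating the cyclic quotient, the fixed-point hypothesis being Schur's lemma for the
irreducible `r`.

## References

* A. H. Clifford, *Representations induced in an invariant subgroup*, Ann. of Math. 38 (1937),
  533–550, §§1–3. [Clifford1937]
* J.-P. Serre, *Linear representations of finite groups*, GTM 42, §2.2 (Schur's lemma), §8.1.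
  [SerreLinearRepresentations1977]
-/

noncomputable section

namespace Literature.NumberTheory.GaloisRepresentations

universe u' v

section Commutant

variable {A : Type*} [Field A] {R : Type*} [Ring R] [Algebra A R]

/-- **The linear algebra core.**  Let `R` be a finite-dimensional algebra over an algebraically
closed field `A` of characteristic zero, `S ⊆ R`, `b ∈ Rˣ` and `d > 0` such that `b⁻¹ S b ⊆ S`,
`b ^ d` commutes with the commutant `E` of `S`, and every element of `E` commuting with `b` is a
scalar.  If `E` contains a non-scalar element, then there are `ζ ∈ A` with `ζ ^ d = 1`, `ζ ≠ 1`,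
and `T ∈ E`, `T ≠ 0`, with `b T b⁻¹ = ζ T`.  (Conjugation by `b` is an endomorphism `Φ` of `E` with
`Φ ^ d = 1` and fixed space the scalars; the kernel of the averaging projector `∑_{k<d} Φᵏ` is a
non-zero `Φ`-stable subspace, on which `Φ` has an eigenvector.) [folklore] -/
theorem exists_conj_eq_smul_of_mem_centralizer [IsAlgClosed A] [CharZero A]
    [FiniteDimensional A R] (S : Set R) (b : Rˣ) {d : ℕ} (hd : 0 < d)
    (hS : ∀ s ∈ S, (↑b⁻¹ : R) * s * ↑b ∈ S)
    (hbd : ∀ T ∈ Subalgebra.centralizer A S, (↑(b ^ d) : R) * T = T * ↑(b ^ d))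
    (hfix : ∀ T ∈ Subalgebra.centralizer A S, (↑b : R) * T = T * ↑b →
      ∃ c : A, T = algebraMap A R c)
    {T₀ : R} (hT₀ : T₀ ∈ Subalgebra.centralizer A S) (hT₀' : ∀ c : A, T₀ ≠ algebraMap A R c) :
    ∃ (ζ : A) (T : R), ζ ^ d = 1 ∧ ζ ≠ 1 ∧ T ≠ 0 ∧ T ∈ Subalgebra.centralizer A S ∧
      (↑b : R) * T * ↑b⁻¹ = ζ • T := by
  classical
  set E := Subalgebra.centralizer A S with hE_def
  have hd0 : (d : A) ≠ 0 := Nat.cast_ne_zero.2 hd.ne'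
  -- conjugation by `b`, a linear endomorphism `Φ` of `R`
  obtain ⟨Φ, hΦ⟩ : ∃ Φ : Module.End A R, ∀ T, Φ T = ↑b * T * ↑b⁻¹ :=
    ⟨LinearMap.mulRight A (↑b⁻¹ : R) ∘ₗ LinearMap.mulLeft A (↑b : R), fun T => rfl⟩
  have hsucc : ∀ (k : ℕ) (T : R), (Φ ^ (k + 1)) T = Φ ((Φ ^ k) T) := fun k T => by
    rw [pow_succ', Module.End.mul_apply]
  have hΦpow : ∀ (k : ℕ) (T : R), (Φ ^ k) T = ↑(b ^ k) * T * ↑(b ^ k)⁻¹ := by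
    intro k
    induction k with
    | zero =>
      intro T
      rw [pow_zero, Module.End.one_apply, pow_zero, inv_one, Units.val_one, one_mul, mul_one]
    | succ k ih =>
      intro T
      rw [hsucc, ih, hΦ, pow_succ', mul_inv_rev, Units.val_mul, Units.val_mul]
      simp only [mul_assoc]
  -- `E` is `Φ`-stable (as `b` normalises `S`)
  have hΦE : ∀ T ∈ E, Φ T ∈ E := fun T hT => by
    rw [hE_def, Subalgebra.mem_centralizer_iff] at hT ⊢
    intro s hs
    have h1 := hT _ (hS s hs)
    rw [hΦ]
    calc s * (↑b * T * ↑b⁻¹) = ↑b * (↑b⁻¹ * s * ↑b * T) * ↑b⁻¹ := by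
          simp only [mul_assoc, Units.mul_inv_cancel_left]
      _ = ↑b * (T * (↑b⁻¹ * s * ↑b)) * ↑b⁻¹ := by rw [h1]
      _ = ↑b * T * ↑b⁻¹ * s := by simp only [mul_assoc, Units.mul_inv, mul_one]
  have hΦpowE : ∀ (k : ℕ), ∀ T ∈ E, (Φ ^ k) T ∈ E := fun k => by
    induction k with
    | zero => intro T hT; rwa [pow_zero, Module.End.one_apply]
    | succ k ih => intro T hT; rw [hsucc]; exact hΦE _ (ih T hT)
  -- `Φ ^ d = 1` on `E`
  have hΦd : ∀ T ∈ E, (Φ ^ d) T = T := fun T hT => by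
    rw [hΦpow, hbd T hT, Units.mul_inv_cancel_right]
  -- `Φ` fixes the scalars, and the `Φ`-fixed elements of `E` are scalars
  have hΦc : ∀ c : A, Φ (algebraMap A R c) = algebraMap A R c := fun c => by
    rw [hΦ, ← Algebra.commutes c (↑b : R), Units.mul_inv_cancel_right]
  have hfixE : ∀ T ∈ E, Φ T = T → ∃ c : A, T = algebraMap A R c := fun T hT h =>
    hfix T hT (by
      rw [hΦ] at h
      calc (↑b : R) * T = ↑b * T * ↑b⁻¹ * ↑b := by rw [Units.inv_mul_cancel_right]
        _ = T * ↑b := by rw [h])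
  -- the averaging operator
  obtain ⟨avg, havg_def⟩ : ∃ avg : Module.End A R, avg = ∑ k ∈ Finset.range d, Φ ^ k :=
    ⟨_, rfl⟩
  have havg : ∀ T, avg T = ∑ k ∈ Finset.range d, (Φ ^ k) T := fun T => by
    rw [havg_def, LinearMap.sum_apply]
  have havgE : ∀ T ∈ E, avg T ∈ E := fun T hT => by
    rw [havg]
    exact sum_mem fun k _ => hΦpowE k T hT
  have hshift : ∀ T ∈ E, ∑ k ∈ Finset.range d, (Φ ^ (k + 1)) T = avg T := fun T hT => by
    have h1 := (Finset.sum_range_succ' (fun k => (Φ ^ k) T) d).symm.trans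
      (Finset.sum_range_succ (fun k => (Φ ^ k) T) d)
    rw [pow_zero, Module.End.one_apply, hΦd T hT] at h1
    rw [havg]
    exact add_right_cancel h1
  have hΦavg : ∀ T ∈ E, Φ (avg T) = avg T := fun T hT => by
    conv_rhs => rw [← hshift T hT]
    rw [havg, map_sum]
    exact Finset.sum_congr rfl fun k _ => (hsucc k T).symm
  have havgΦ : ∀ T ∈ E, avg (Φ T) = avg T := fun T hT => by
    rw [havg, ← hshift T hT]
    exact Finset.sum_congr rfl fun k _ => by rw [pow_succ, Module.End.mul_apply]
  have havgc : ∀ c : A, avg (algebraMap A R c) = (d : A) • algebraMap A R c := fun c => by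
    have hk : ∀ k : ℕ, (Φ ^ k) (algebraMap A R c) = algebraMap A R c := fun k => by
      induction k with
      | zero => rw [pow_zero, Module.End.one_apply]
      | succ k ih => rw [hsucc, ih, hΦc]
    rw [havg]
    simp only [hk, Finset.sum_const, Finset.card_range]
    rw [Nat.cast_smul_eq_nsmul]
  -- the `Φ`-stable subspace `K = E ∩ ker avg`
  let K : Submodule A R := Subalgebra.toSubmodule E ⊓ LinearMap.ker avg
  have hKΦ : ∀ T ∈ K, Φ T ∈ K := fun T hT => by
    obtain ⟨hTE, hTk⟩ := Submodule.mem_inf.1 hT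
    rw [Subalgebra.mem_toSubmodule] at hTE
    rw [LinearMap.mem_ker] at hTk
    refine Submodule.mem_inf.2 ⟨?_, ?_⟩
    · rw [Subalgebra.mem_toSubmodule]
      exact hΦE T hTE
    · rw [LinearMap.mem_ker, havgΦ T hTE, hTk]
  -- `K ≠ 0`: it contains `T₀ - d⁻¹ avg T₀`, and `avg T₀` is a scalar while `T₀` is not
  obtain ⟨c₀, hc₀⟩ := hfixE (avg T₀) (havgE T₀ hT₀) (hΦavg T₀ hT₀)
  have hv₀K : T₀ - algebraMap A R ((d : A)⁻¹ * c₀) ∈ K := by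
    refine Submodule.mem_inf.2 ⟨?_, ?_⟩
    · rw [Subalgebra.mem_toSubmodule]
      exact sub_mem hT₀ (E.algebraMap_mem _)
    · rw [LinearMap.mem_ker, map_sub, havgc, hc₀, Algebra.smul_def, ← map_mul, ← mul_assoc,
        mul_inv_cancel₀ hd0, one_mul, sub_self]
  have hv₀0 : T₀ - algebraMap A R ((d : A)⁻¹ * c₀) ≠ 0 := fun h => hT₀' _ (sub_eq_zero.1 h)
  haveI : Nontrivial K := ⟨⟨⟨_, hv₀K⟩, 0, fun h => hv₀0 (congrArg Subtype.val h)⟩⟩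
  -- an eigenvector of `Φ` on `K`
  obtain ⟨ζ, hζ⟩ := Module.End.exists_eigenvalue (Φ.restrict hKΦ)
  obtain ⟨v, hv⟩ := hζ.exists_hasEigenvector
  have hv0 : v ≠ 0 := (Module.End.hasEigenvector_iff.1 hv).2
  have hT0 : (v : R) ≠ 0 := fun h => hv0 (Subtype.ext h)
  obtain ⟨hTE, hTk⟩ := Submodule.mem_inf.1 v.2
  rw [Subalgebra.mem_toSubmodule] at hTE
  rw [LinearMap.mem_ker] at hTk
  have hΦT : Φ v = ζ • (v : R) := congrArg Subtype.val hv.apply_eq_smul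
  have hΦkT : ∀ k : ℕ, (Φ ^ k) v = ζ ^ k • (v : R) := fun k => by
    induction k with
    | zero => rw [pow_zero, pow_zero, Module.End.one_apply, one_smul]
    | succ k ih => rw [hsucc, ih, map_smul, hΦT, smul_smul, pow_succ]
  -- `ζ ^ d = 1` as `Φ ^ d = 1` on `E`
  have hζd : ζ ^ d = 1 := by
    have h1 := hΦd (v : R) hTE
    rw [hΦkT] at h1
    have h2 : (ζ ^ d - 1) • (v : R) = 0 := by rw [sub_smul, one_smul, h1, sub_self]
    exact sub_eq_zero.1 ((smul_eq_zero.1 h2).resolve_right hT0)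
  -- `ζ ≠ 1` as a `Φ`-fixed element of `ker avg` vanishes (characteristic zero)
  have hζ1 : ζ ≠ 1 := by
    intro hζ
    subst hζ
    have h1 : avg (v : R) = (d : A) • (v : R) := by
      rw [havg]
      simp only [hΦkT, one_pow, one_smul, Finset.sum_const, Finset.card_range]
      rw [Nat.cast_smul_eq_nsmul]
    rw [h1] at hTk
    exact hT0 ((smul_eq_zero.1 hTk).resolve_left hd0)
  exact ⟨ζ, v, hζd, hζ1, hT0, hTE, (hΦ v).symm.trans hΦT⟩

end Commutant

section Framed

variable {H : Type u'} [Group H] [TopologicalSpace H] {A : Type v} [Field A] [TopologicalSpace A]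
  {n : ℕ}

namespace FramedRep

/-- **A reducible, semisimple, non-zero framed representation has a non-scalar endomorphism**: the
projection onto a proper non-trivial subrepresentation `W` along an invariant complement `W'`
(semisimplicity) commutes with the representation and is neither `0` (`W ≠ 0`) nor the identity
(`W ≠ V`), hence is not a scalar. [folklore] -/
theorem exists_comm_ne_algebraMap_of_not_isIrreducible {r : FramedRep H A n} (hn : 0 < n)
    (hss : r.toRepresentation.IsSemisimpleRepresentation) (hred : ¬ r.IsIrreducible) :
    ∃ T : Matrix (Fin n) (Fin n) A,
      (∀ h : H, ((r h : GL (Fin n) A) : Matrix (Fin n) (Fin n) A) * T =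
        T * ((r h : GL (Fin n) A) : Matrix (Fin n) (Fin n) A)) ∧
      ∀ c : A, T ≠ algebraMap A (Matrix (Fin n) (Fin n) A) c := by
  classical
  haveI := hss
  -- `⊥ ≠ ⊤` among the subrepresentations (`n > 0`)
  have hbt : (⊥ : Subrepresentation r.toRepresentation) ≠ ⊤ := fun h => by
    haveI : Nonempty (Fin n) := ⟨⟨0, hn⟩⟩
    exact bot_ne_top (congrArg Subrepresentation.toSubmodule h)
  -- a proper non-trivial subrepresentation `W` (the lattice is not simple) ...
  obtain ⟨W, hWb, hWt⟩ : ∃ W : Subrepresentation r.toRepresentation, W ≠ ⊥ ∧ W ≠ ⊤ := by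
    by_contra hcon
    push Not at hcon
    haveI : Nontrivial (Subrepresentation r.toRepresentation) := ⟨⟨⊥, ⊤, hbt⟩⟩
    exact hred (IsSimpleOrder.of_forall_eq_top hcon)
  -- ... and an invariant complement `W'` (semisimplicity)
  obtain ⟨W', hWW'⟩ := exists_isCompl W
  have hpq : IsCompl W.toSubmodule W'.toSubmodule :=
    isCompl_iff.2 ⟨disjoint_iff.2 (congrArg Subrepresentation.toSubmodule hWW'.inf_eq_bot),
      codisjoint_iff.2 (congrArg Subrepresentation.toSubmodule hWW'.sup_eq_top)⟩
  -- the projection onto `W` along `W'` is equivariant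
  set π := W.toSubmodule.projection W'.toSubmodule hpq with hπ_def
  have hπ : ∀ (h : H) (v : Fin n → A),
      π (r.toRepresentation h v) = r.toRepresentation h (π v) := fun h v => by
    conv_lhs => rw [← Submodule.projection_add_projection_eq_self hpq v]
    rw [map_add, map_add,
      Submodule.projection_apply_of_mem_left hpq
        (W.apply_mem_toSubmodule h (Submodule.projection_apply_mem hpq v)),
      (Submodule.projection_apply_eq_zero_iff hpq).2
        (W'.apply_mem_toSubmodule h (Submodule.projection_apply_mem hpq.symm v)), add_zero]
  have hlin : ∀ h : H, Matrix.toLin' (r h).val = r.toRepresentation h :=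
    fun h => LinearMap.ext fun v => Matrix.toLin'_apply _ _
  refine ⟨LinearMap.toMatrix' π, fun h => ?_, fun c hc => ?_⟩
  · rw [← LinearMap.toMatrix'_toLin' (r h).val, hlin,
      ← LinearMap.toMatrix'_mul, ← LinearMap.toMatrix'_mul]
    exact congrArg LinearMap.toMatrix' (LinearMap.ext fun v => (hπ h v).symm)
  · -- if `π = c • 1` then `c = 1` (`W ≠ 0`) and `W = V`
    have hπv : ∀ v, π v = c • v := fun v => by
      have h1 : π = Matrix.toLin' (algebraMap A (Matrix (Fin n) (Fin n) A) c) := by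
        rw [← hc, Matrix.toLin'_toMatrix']
      rw [h1, Matrix.toLin'_apply, Algebra.algebraMap_eq_smul_one, Matrix.smul_mulVec,
        Matrix.one_mulVec]
    obtain ⟨x, hxW, hx0⟩ := (Submodule.ne_bot_iff W.toSubmodule).1 fun h =>
      hWb (Subrepresentation.toSubmodule_injective h)
    have hc1 : c = 1 := by
      have h1 : c • x = x := by rw [← hπv, Submodule.projection_apply_of_mem_left hpq hxW]
      have h2 : (c - 1) • x = 0 := by rw [sub_smul, one_smul, h1, sub_self]
      exact sub_eq_zero.1 ((smul_eq_zero.1 h2).resolve_right hx0)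
    have hWtop : W.toSubmodule = ⊤ := eq_top_iff.2 fun v _ => by
      have h1 := Submodule.projection_apply_mem hpq v
      rwa [hπv, hc1, one_smul] at h1
    exact hWt (Subrepresentation.toSubmodule_injective hWtop)

end FramedRep

end Framed

end Literature.NumberTheory.GaloisRepresentations

end
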